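import Mathlib
import HarnessLib

/-!
# Sparse dyadic rationals near a rational with small denominator (Green 2012, Lemma 1; Harman–Kátai)

Topic `Literature/NumberTheory/LFunctions`. An elementary diophantine lemma from B. Green,
*On (not) computing the Möbius function using bounded depth circuits*, Combin. Probab. Comput.
21 (2012) 942–951 (arXiv:1103.4991), §4, **Lemma 1** ("the following key observation of Harman
and Kátai [Primes with preassigned digits II, Acta Arith. 133 (2008)], allowing one to conclude
that none of these exceptional values of `θ` are sparse dyadic rationals"), PROVED:

> Suppose that `θ = r₁/2^{i₁} + ⋯ + r_k/2^{i_k}`, where `i₁ < ⋯ < i_k ≤ n` and `|rᵢ| ≤ Q` for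
> all `i`. Suppose furthermore that there is some `q ≤ Q` and an `a` coprime to `q` such that
> `|θ − a/q| ≤ Q/N` (`N = 2ⁿ`), and that we have `2^{n/2k} > 4Q²`. Then `q` is a power of two.

This is the step of the proof of Green's Proposition 3 (exponential sums over `μ` at sparse
dyadic rationals; the input of Proposition 1, the tree's named facts
`green_moebius_fourierWalsh` / `green_liouville_fourierWalsh` of
`Literature/NumberTheory/LFunctions/MoebiusWalshCircuits.lean`) that funnels the minor-arc
denominator `q` into the `2`-power moduli of Green's Theorem 3 (the tree's named fact
`green_moebius_character_twoPower`).

## Rendering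

* The exponents are an injective family `i : Fin k → ℕ` (the printed `i₁ < ⋯ < i_k ≤ n`; the
  bound `≤ n` is not used), the numerators `r : Fin k → ℤ` with `|r j| ≤ Q`,
  `θ = Σ_j r_j / 2^{i_j}`, `a : ℤ` with `Int.gcd a q = 1`, `1 ≤ q ≤ Q`.
* The printed hypothesis `2^{n/2k} > 4Q²` is used in the proof only through the pigeonhole
  gap: "there is some index `j` with `i_{j+1} − i_j ≥ n/2k`" (with `i₀ = 0`, `i_{k+1} = n`). We
  state the hypothesis in the slightly more flexible form `(k + 1) g ≤ n ∧ 4Q² < 2^g` for a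
  natural number `g` (the printed case being `g = ⌈n/2k⌉`-ish: `k + 1` gaps of total length `n`
  force a gap `≥ n/(k+1) ≥ n/2k`), which is what the pigeonhole delivers
  (`exists_gap_of_card_lt`) and what the consumer (proof of Proposition 3, `k < n^{1/2}`,
  `Q = e^{c₄√log N}`) verifies.
* Conclusion `∃ e, q = 2 ^ e` (the printed proof also gets `q = 2^{i_j}`, `a = a'`; only
  `q ∣ 2^{i_j}` is needed and true in general).

## References

* B. Green, *On (not) computing the Möbius function using bounded depth circuits*, Combin.
  Probab. Comput. 21 (2012), §4 Lemma 1 [Green2012].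
* G. Harman, I. Kátai, *Primes with preassigned digits II*, Acta Arith. 133 (2008), 171–184.
-/

noncomputable section

open Finset

namespace Literature.NumberTheory.LFunctions

namespace SparseDyadic

/-- **Pigeonhole for the gap** (Green: "Set `i₀ := 0` and `i_{k+1} := n`. By the pigeonhole
principle there is some index `j` such that `|i_j − i_{j+1}| ≥ n/2k`"): `k` naturals leave one
of the `k + 1` blocks `[mg, (m+1)g)`, `m ≤ k`, free, so with `c = mg`, `c' = (m+1)g ≤ (k+1)g ≤ n`
every `i_j` is `≤ c` or `≥ c'`. [cite: Green2012, §4 Lemma 1 (proof)] -/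
theorem exists_gap_of_card_lt {k n g : ℕ} (i : Fin k → ℕ) (hkg : (k + 1) * g ≤ n) :
    ∃ c c' : ℕ, c + g ≤ c' ∧ c' ≤ n ∧ ∀ j, i j < c ∨ c' ≤ i j := by
  classical
  have hcard : (univ.image fun j : Fin k => i j / g).card < (range (k + 1)).card := by
    calc (univ.image fun j : Fin k => i j / g).card ≤ (univ : Finset (Fin k)).card := card_image_le
      _ = k := by simp
      _ < (range (k + 1)).card := by simp
  obtain ⟨m, hm, hmi⟩ := exists_mem_notMem_of_card_lt_card hcard
  rw [mem_range] at hm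
  refine ⟨m * g, (m + 1) * g, by ring_nf; omega, ?_, fun j => ?_⟩
  · exact le_trans (Nat.mul_le_mul_right g (by omega)) hkg
  · have hne : i j / g ≠ m := fun h => hmi (mem_image.2 ⟨j, mem_univ _, h⟩)
    rcases lt_or_ge (i j) (m * g) with hlt | hge
    · exact Or.inl hlt
    · right
      by_contra hcon
      push Not at hcon
      apply hne
      exact Nat.div_eq_of_lt_le hge hcon

/-- **A sparse geometric tail**: distinct exponents `≥ c'` give `Σ_{x ∈ T} 2^{-x} ≤ 2 · 2^{-c'}`
(Green: "`|θ − a'/q'| ≤ Q(2^{−i_{j+1}} + 2^{−i_{j+2}} + ⋯) ≤ 2^{−n/2k} 2Q/q'`"). [cite: Green2012, §4 Lemma 1 (proof)] -/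
theorem sum_half_pow_le (T : Finset ℕ) {c' : ℕ} (hT : ∀ x ∈ T, c' ≤ x) :
    ∑ x ∈ T, ((1 : ℝ) / 2) ^ x ≤ 2 * ((1 : ℝ) / 2) ^ c' := by
  have hshift : ∑ x ∈ T, ((1 : ℝ) / 2) ^ x = ((1 : ℝ) / 2) ^ c' * ∑ x ∈ T, ((1 : ℝ) / 2) ^ (x - c') := by
    rw [mul_sum]
    refine sum_congr rfl fun x hx => ?_
    rw [← pow_add, Nat.add_sub_cancel' (hT x hx)]
  rw [hshift, mul_comm]
  refine mul_le_mul_of_nonneg_right ?_ (by positivity)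
  -- reindex by `x ↦ x - c'` (injective on `T`) and compare with the full geometric series
  have hinj : Set.InjOn (fun x => x - c') (T : Set ℕ) := by
    intro x hx y hy hxy
    have := hT x hx; have := hT y hy
    simp only at hxy
    omega
  rw [← sum_image (f := fun y => ((1 : ℝ) / 2) ^ y) hinj]
  calc ∑ y ∈ T.image (fun x => x - c'), ((1 : ℝ) / 2) ^ y ≤ ∑' y : ℕ, ((1 : ℝ) / 2) ^ y :=
        (summable_geometric_two).sum_le_tsum _ (fun y _ => by positivity)
    _ = 2 := tsum_geometric_two

end SparseDyadic

open SparseDyadic in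
/-- **Green 2012, Lemma 1 (Harman–Kátai): a sparse dyadic rational close to `a/q` with `q`
small forces `q` to be a power of two.** Printed: "Suppose that `θ = r₁/2^{i₁} + ⋯ + r_k/2^{i_k}`,
where `i₁ < ⋯ < i_k ≤ n` and `|rᵢ| ≤ Q` for all `i`. Suppose furthermore that there is some
`q ≤ Q` and an `a` coprime to `q` such that `|θ − a/q| ≤ Q/N`, and that we have `2^{n/2k} > 4Q²`.
Then `q` is a power of two." Here `N = 2ⁿ`, the exponents form an injective family
`i : Fin k → ℕ` (the bound `i_j ≤ n` turns out not to be needed), and the size hypothesis is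
taken in the form the printed pigeonhole uses it: a natural `g` with `(k+1) g ≤ n` and
`4Q² < 2^g`. Proof as printed: a free
block `[c, c')` of length `≥ g` (pigeonhole), `q' = 2^c`, `a' = Σ_{i_j ≤ c} r_j 2^{c − i_j}`,
`|θ − a'/q'| ≤ 2Q 2^{−c'} < 1/(2Qq')`, `Q/N < 1/(4Qq')`, hence `|a/q − a'/q'| < 1/(qq')`,
`aq' = a'q`, and `(a, q) = 1` gives `q ∣ 2^c`. [cite: Green2012, §4 Lemma 1] -/
theorem twoPower_of_sparseDyadic_near {k n g : ℕ} {Q : ℝ} (i : Fin k → ℕ) (hi : Function.Injective i)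
    (r : Fin k → ℤ) (hr : ∀ j, |(r j : ℝ)| ≤ Q)
    {q : ℕ} (hq : 1 ≤ q) (hqQ : (q : ℝ) ≤ Q) {a : ℤ} (hcop : Int.gcd a q = 1)
    (hθ : |∑ j, (r j : ℝ) / 2 ^ (i j) - a / q| ≤ Q / 2 ^ n)
    (hkg : (k + 1) * g ≤ n) (hgap : 4 * Q ^ 2 < (2 : ℝ) ^ g) :
    ∃ e : ℕ, q = 2 ^ e := by
  classical
  have hq0 : (0 : ℝ) < q := by exact_mod_cast hq
  have hq1 : (1 : ℝ) ≤ q := by exact_mod_cast hq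
  have hQ1 : 1 ≤ Q := hq1.trans hqQ
  have hQ0 : 0 < Q := by linarith
  -- `g ≥ 1` (else `4Q² < 1`)
  have hg : 0 < g := by
    rcases Nat.eq_zero_or_pos g with rfl | h
    · rw [pow_zero] at hgap; nlinarith
    · exact h
  obtain ⟨c, c', hcc', hc'n, hsplit⟩ := exists_gap_of_card_lt i hkg
  -- the two halves of `θ`
  set θ : ℝ := ∑ j, (r j : ℝ) / 2 ^ (i j) with hθdef
  set A : Finset (Fin k) := univ.filter (fun j => i j < c) with hA
  set B : Finset (Fin k) := univ.filter (fun j => ¬ i j < c) with hB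
  have hBge : ∀ j ∈ B, c' ≤ i j := by
    intro j hj
    rw [hB, mem_filter] at hj
    exact (hsplit j).resolve_left hj.2
  have hθsplit : θ = ∑ j ∈ A, (r j : ℝ) / 2 ^ (i j) + ∑ j ∈ B, (r j : ℝ) / 2 ^ (i j) := by
    rw [hθdef, hA, hB, sum_filter_add_sum_filter_not]
  -- `q' = 2^c`, `a' = Σ_A r_j 2^{c - i_j}`
  set q' : ℕ := 2 ^ c with hq'
  set a' : ℤ := ∑ j ∈ A, r j * 2 ^ (c - i j) with ha'
  have hq'0 : (0 : ℝ) < q' := by rw [hq']; positivity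
  have hq'R : (q' : ℝ) = 2 ^ c := by rw [hq']; push_cast; ring
  have ha'q' : (a' : ℝ) / q' = ∑ j ∈ A, (r j : ℝ) / 2 ^ (i j) := by
    rw [hq'R, ha']
    push_cast
    rw [sum_div]
    refine sum_congr rfl fun j hj => ?_
    rw [hA, mem_filter] at hj
    have hle : i j ≤ c := hj.2.le
    have h2 : (2 : ℝ) ^ c = 2 ^ (c - i j) * 2 ^ (i j) := by rw [← pow_add, Nat.sub_add_cancel hle]
    rw [h2]
    field_simp
  -- the tail `|θ - a'/q'| ≤ 2 Q 2^{-c'}`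
  have htail : |θ - a' / q'| ≤ 2 * Q * ((1 : ℝ) / 2) ^ c' := by
    rw [ha'q', hθsplit, add_sub_cancel_left]
    calc |∑ j ∈ B, (r j : ℝ) / 2 ^ (i j)| ≤ ∑ j ∈ B, |(r j : ℝ) / 2 ^ (i j)| := abs_sum_le_sum_abs _ _
      _ ≤ ∑ j ∈ B, Q * ((1 : ℝ) / 2) ^ (i j) := by
          refine sum_le_sum fun j _ => ?_
          rw [abs_div, abs_of_pos (by positivity : (0 : ℝ) < 2 ^ (i j)), one_div_pow, ← div_eq_mul_one_div]
          exact div_le_div_of_nonneg_right (hr j) (by positivity)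
      _ = Q * ∑ x ∈ B.image i, ((1 : ℝ) / 2) ^ x := by
          rw [← mul_sum, sum_image fun x _ y _ h => hi h]
      _ ≤ Q * (2 * ((1 : ℝ) / 2) ^ c') := by
          refine mul_le_mul_of_nonneg_left (sum_half_pow_le _ fun x hx => ?_) hQ0.le
          obtain ⟨j, hj, rfl⟩ := mem_image.1 hx
          exact hBge j hj
      _ = 2 * Q * ((1 : ℝ) / 2) ^ c' := by ring
  -- numerics: `2^{c'} ≥ 2^c 2^g > q' · 4Q²`
  have hpow : (q' : ℝ) * (4 * Q ^ 2) < 2 ^ c' := by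
    calc (q' : ℝ) * (4 * Q ^ 2) < 2 ^ c * 2 ^ g := by
          rw [hq'R]; exact mul_lt_mul_of_pos_left hgap (by positivity)
      _ = 2 ^ (c + g) := (pow_add _ _ _).symm
      _ ≤ 2 ^ c' := pow_le_pow_right₀ (by norm_num) hcc'
  have hhalf : ((1 : ℝ) / 2) ^ c' = 1 / 2 ^ c' := by rw [one_div_pow]
  have h2c' : (0 : ℝ) < 2 ^ c' := by positivity
  have htail' : |θ - a' / q'| < 1 / (2 * Q * q') := by
    refine htail.trans_lt ?_
    rw [hhalf, mul_one_div, div_lt_div_iff₀ h2c' (by positivity)]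
    nlinarith
  have hmaj : |θ - a / q| < 1 / (4 * Q * q') := by
    refine hθ.trans_lt ?_
    have h1 : Q / 2 ^ n ≤ Q / 2 ^ c' := div_le_div_of_nonneg_left hQ0.le h2c' (pow_le_pow_right₀ (by norm_num) hc'n)
    refine h1.trans_lt ?_
    rw [div_lt_div_iff₀ h2c' (by positivity)]
    nlinarith
  -- `|a/q - a'/q'| < 1/(q q')`, hence `a q' = a' q`
  have hdiff : |(a : ℝ) / q - a' / q'| < 1 / (q * q') := by
    have h1 : |(a : ℝ) / q - a' / q'| ≤ |θ - a' / q'| + |θ - a / q| := by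
      rw [show (a : ℝ) / q - a' / q' = (θ - a' / q') - (θ - a / q) by ring]
      exact abs_sub _ _
    have h2 : 1 / (2 * Q * q') + 1 / (4 * Q * q') < 1 / (q * q') := by
      rw [show 1 / (2 * Q * q') + 1 / (4 * Q * q') = 3 / (4 * Q * q') by field_simp; ring]
      rw [div_lt_div_iff₀ (by positivity) (by positivity)]
      have : (q : ℝ) * q' ≤ Q * q' := mul_le_mul_of_nonneg_right hqQ hq'0.le
      nlinarith
    linarith
  have heq : a * q' = a' * q := by
    have h1 : |((a * q' - a' * q : ℤ) : ℝ)| < 1 := by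
      have e : ((a * q' - a' * q : ℤ) : ℝ) = ((a : ℝ) / q - a' / q') * (q * q') := by
        push_cast; field_simp
      rw [e, abs_mul, abs_of_pos (by positivity : (0 : ℝ) < q * q')]
      have := mul_lt_mul_of_pos_right hdiff (by positivity : (0 : ℝ) < q * q')
      rwa [one_div, inv_mul_cancel₀ (by positivity)] at this
    have h2 : (a * q' - a' * q : ℤ) = 0 := by
      have h3 : |(a * q' - a' * q : ℤ)| < 1 := by exact_mod_cast h1
      exact Int.abs_lt_one_iff.1 h3
    omega
  -- `(a, q) = 1` gives `q ∣ q' = 2^c`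
  have hdvd : (q : ℤ) ∣ (q' : ℤ) := by
    have hcopr : IsCoprime (q : ℤ) a := (Int.isCoprime_iff_gcd_eq_one.2 hcop).symm
    refine hcopr.dvd_of_dvd_mul_left ⟨a', ?_⟩
    rw [heq]; ring
  have hdvd' : q ∣ 2 ^ c := by rw [hq'] at hdvd; exact_mod_cast hdvd
  obtain ⟨e, -, he⟩ := (Nat.dvd_prime_pow Nat.prime_two).1 hdvd'
  exact ⟨e, he⟩

end Literature.NumberTheory.LFunctions

end
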